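import Summits.SmoothPoincare4.SmoothPoincare4.Theorems.SymplecticOrigamiGromovRecognitionRelEndHelperNwtKSide
import Literature.Geometry.Symplectic.ProjectiveLineProductCharts

/-!
# Crossing helper for `GromovRecognitionRelEnd` (line cross-cap-laurent): K-side bookkeeping of the transfer step

Support lemma for crux `stmt-SmoothPoincare4-11009` (child stub `stub_normalWitnessTransfer` of the split
piece `AdjunctionEmbeddedSpheres`). From `helper_nwtKSide` (the pushed-off fibre `K_s = ι(ℂℙ¹ × {s})` of the
product neighbourhood of the witness sphere, transverse to the new sphere `Σ = F(ℂℙ¹)`, together with the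
homological count `Σ_z wind = 0`) we extract exactly the data consumed by `helper_nwtIndexSum` and by the
sphere-section step: the product chart `Φ = prodChart 0 ι'` of the re-parametrised neighbourhood
`ι' (θ, t) = ι (A·θ, t)`, the finite set `ZK` of crossing parameters with the matching `Σ`-parameters `zc`,
the vanishing count re-indexed over `ZK`, and the position of the sphere `G = K_s` relative to `Σ` off the
crossings.
-/

noncomputable section

open scoped Manifold ContDiff Topology
open Set Function Literature.Topology.FourManifolds Literature.Topology.FourManifolds.ComplexProjectiveSpace
  Literature.Topology.PlaneTopology Literature.Geometry.Symplectic

set_option linter.dupNamespace false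

namespace Summit.SmoothPoincare4.SmoothPoincare4.Theorems.GromovRecognitionRelEnd.CrossCapLaurent

set_option maxHeartbeats 800000 in
/-- **K-side data of the transfer step.** For an embedded two-chart sphere `Σ = (u, v, F)` homotopic to the
witness sphere `Σ₀ = (u₀, v₀, F₀)` (with its trivial-normal-bundle witness `(N, π)`): an open set `UK ⊆ N` with a
submersion `g`, an immersion `Φ : ℂ × ℂ → UK` with `g ∘ Φ = pr₂`, a level `s`, the finite set `ZK` of
parameters `ζ` with `Φ (ζ, s) ∈ Σ` and the corresponding `u`-parameters `zc`, transversality of `g ∘ u` there,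
the vanishing signed count, and a sphere `G ≃ F` through the slice `t = s` (`G (linePt 0 ζ) = Φ (ζ, s)`)
missing `Σ` away from the crossings. -/
theorem helper_nwtInnerK : ∀ (X : Type) [TopologicalSpace X] [T2Space X] [SecondCountableTopology X] [ChartedSpace (EuclideanSpace ℝ (Fin 4)) X] [IsManifold (𝓡 4) ∞ X] (u v u₀ v₀ : ℂ → X) (N : Set X) (π : X → ℂ) (F F₀ : C(Literature.Topology.FourManifolds.ComplexProjectiveSpace 1, X)), ContMDiff 𝓘(ℝ, ℂ) (𝓡 4) ∞ u → ContMDiff 𝓘(ℝ, ℂ) (𝓡 4) ∞ v → (∀ z : ℂ, z ≠ 0 → v z = u z⁻¹) → Function.Injective u → v 0 ∉ Set.range u → (∀ p, Literature.Topology.FourManifolds.ComplexProjectiveSpace.CoordNeZero 0 p → F p = u (Literature.Topology.FourManifolds.ComplexProjectiveSpace.affineCoordComplex 0 p 0)) → (∀ p, Literature.Topology.FourManifolds.ComplexProjectiveSpace.CoordNeZero 1 p → F p = v (Literature.Topology.FourManifolds.ComplexProjectiveSpace.affineCoordComplex 1 p 0)) → ContMDiff 𝓘(ℝ, ℂ)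 (𝓡 4) ∞ u₀ → ContMDiff 𝓘(ℝ, ℂ) (𝓡 4) ∞ v₀ → (∀ z : ℂ, z ≠ 0 → v₀ z = u₀ z⁻¹) → Function.Injective u₀ → (∀ z, Function.Injective (mfderiv 𝓘(ℝ, ℂ) (𝓡 4) u₀ z)) → Function.Injective (mfderiv 𝓘(ℝ, ℂ) (𝓡 4) v₀ 0) → v₀ 0 ∉ Set.range u₀ → IsOpen N → Set.range u₀ ∪ {v₀ 0} ⊆ N → ContMDiffOn (𝓡 4) 𝓘(ℝ, ℂ) ∞ π N → (∀ y ∈ N, Function.Surjective (mfderiv (𝓡 4) 𝓘(ℝ, ℂ) π y)) → {y | y ∈ N ∧ π y = 0} = Set.range u₀ ∪ {v₀ 0} → (∀ p, Literature.Topology.FourManifolds.ComplexProjectiveSpace.CoordNeZero 0 p → F₀ p = u₀ (Literature.Topology.FourManifolds.ComplexProjectiveSpace.affineCoordComplex 0 p 0)) → (∀ p, Literature.Topology.FourManifolds.ComplexProjectiveSpace.CoordNeZero 1 p → F₀ p = v₀ (Literature.Topology.FourManifolds.ComplexProjectiveSpace.affineCoordComplex 1 p 0)) → F.Homotopic F₀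 → ∃ (UK : Set X) (g : X → ℂ) (Φ : ℂ × ℂ → X) (s : ℂ) (ZK : Finset ℂ) (zc : ℂ → ℂ) (G : C(Literature.Topology.FourManifolds.ComplexProjectiveSpace 1, X)), IsOpen UK ∧ ContMDiffOn (𝓡 4) 𝓘(ℝ, ℂ) ∞ g UK ∧ ContMDiff 𝓘(ℝ, ℂ × ℂ) (𝓡 4) ∞ Φ ∧ (∀ q, Function.Injective (mfderiv 𝓘(ℝ, ℂ × ℂ) (𝓡 4) Φ q)) ∧ (∀ q, Φ q ∈ UK) ∧ (∀ q, g (Φ q) = q.2) ∧ (∀ ζ ∈ ZK, Φ (ζ, s) = u (zc ζ)) ∧ (∀ ζ ∈ ZK, Function.Surjective (mfderiv 𝓘(ℝ, ℂ) 𝓘(ℝ, ℂ) (fun z => g (u z)) (zc ζ))) ∧ (∃ r₀ : ℝ, 0 < r₀ ∧ ∀ r : ℝ, 0 < r → r ≤ r₀ → ∑ ζ ∈ ZK, Literature.Topology.PlaneTopology.wind (fun θ => g (u (Literature.Topology.PlaneTopology.circleLoop (zc ζ) r θ)) - s) = 0) ∧ (∀ z : ℂ, G (Literature.Topology.FourManifolds.CodimTwoData.linePt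 0 z) = Φ (z, s)) ∧ (∀ θ, θ ∉ Literature.Topology.FourManifolds.CodimTwoData.linePt 0 '' (↑ZK : Set ℂ) → G θ ∉ Set.range u ∪ {v 0}) ∧ G.Homotopic F := by
  intro X _ _ _ _ _ u v u₀ v₀ N π F F₀ hu hv huv huinj hv0 hFu hFv hu₀ hv₀ huv₀ hu₀inj hu₀imm hv₀imm hv₀0 hN hSN hπ hπs hzero
    hF₀u hF₀v hFF₀
  classical
  obtain ⟨UK, g, ι, s, A, G, hUK, -, hg, -, hιs, hιinj, hιd, hιr, hgι, hG, hGF, hGinf, hv0K, hreg, hfin, -, r₀, hr₀, hsum⟩ :=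
    helper_nwtKSide X u v u₀ v₀ N π F F₀ hu hv huv huinj hv0 hFu hFv hu₀ hv₀ huv₀ hu₀inj hu₀imm hv₀imm hv₀0 hN hSN hπ hπs hzero
      hF₀u hF₀v hFF₀
  -- the re-parametrised product neighbourhood `ι' (θ, t) = ι (A·θ, t)`
  obtain ⟨ι', hι'⟩ : ∃ ι' : ComplexProjectiveSpace 1 × ℂ → X, ι' = fun q => ι (PlusOneSpherePair.projectiveMap A q.1, q.2) :=
    ⟨_, rfl⟩
  have hpm : ContMDiff (𝓡 2) (𝓡 2) ∞ (PlusOneSpherePair.projectiveMap (n := 1) A) := PlusOneSpherePair.contMDiff_projectiveMap A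
  have hψ : ∀ q : ComplexProjectiveSpace 1 × ℂ, HasMFDerivAt ((𝓡 2).prod 𝓘(ℝ, ℂ)) ((𝓡 2).prod 𝓘(ℝ, ℂ))
      (fun q : ComplexProjectiveSpace 1 × ℂ => (PlusOneSpherePair.projectiveMap A q.1, q.2)) q
      (((mfderiv (𝓡 2) (𝓡 2) (PlusOneSpherePair.projectiveMap A) q.1).comp
        (ContinuousLinearMap.fst ℝ (EuclideanSpace ℝ (Fin 2)) ℂ)).prod (ContinuousLinearMap.snd ℝ (EuclideanSpace ℝ (Fin 2)) ℂ)) :=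
    fun q => (((hpm q.1).mdifferentiableAt (by simp)).hasMFDerivAt.comp q (hasMFDerivAt_fst q)).prodMk (hasMFDerivAt_snd q)
  have hι's : ContMDiff ((𝓡 2).prod 𝓘(ℝ, ℂ)) (𝓡 4) ∞ ι' := by
    rw [hι']; exact hιs.comp ((hpm.comp contMDiff_fst).prodMk contMDiff_snd)
  have hι'd : ∀ q, Injective (mfderiv ((𝓡 2).prod 𝓘(ℝ, ℂ)) (𝓡 4) ι' q) := by
    intro q
    have hc : HasMFDerivAt ((𝓡 2).prod 𝓘(ℝ, ℂ)) (𝓡 4) (fun q : ComplexProjectiveSpace 1 × ℂ => ι (PlusOneSpherePair.projectiveMap A q.1, q.2)) q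
        ((mfderiv ((𝓡 2).prod 𝓘(ℝ, ℂ)) (𝓡 4) ι (PlusOneSpherePair.projectiveMap A q.1, q.2)).comp
          (((mfderiv (𝓡 2) (𝓡 2) (PlusOneSpherePair.projectiveMap A) q.1).comp
            (ContinuousLinearMap.fst ℝ (EuclideanSpace ℝ (Fin 2)) ℂ)).prod (ContinuousLinearMap.snd ℝ (EuclideanSpace ℝ (Fin 2)) ℂ))) :=
      ((hιs _).mdifferentiableAt (by simp)).hasMFDerivAt.comp q (hψ q)
    rw [hι', hc.mfderiv]
    refine (hιd _).comp ?_
    intro w w' h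
    have h' : (mfderiv (𝓡 2) (𝓡 2) (PlusOneSpherePair.projectiveMap A) q.1 w.1, w.2) =
        (mfderiv (𝓡 2) (𝓡 2) (PlusOneSpherePair.projectiveMap A) q.1 w'.1, w'.2) := h
    obtain ⟨h1, h2⟩ := Prod.mk.inj h'
    have hinjA : Injective (mfderiv (𝓡 2) (𝓡 2) (PlusOneSpherePair.projectiveMap A) q.1) := fun a b hab =>
      ((PlusOneSpherePair.projectiveDiffeo A ∞).mfderivToContinuousLinearEquiv (by simp) q.1).injective hab
    exact Prod.ext (hinjA h1) h2
  have hι'inj : Injective ι' := by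
    rw [hι']
    intro q q' h
    have h' : (PlusOneSpherePair.projectiveMap A q.1, q.2) = (PlusOneSpherePair.projectiveMap A q'.1, q'.2) := hιinj h
    have h1 : q.1 = q'.1 := by
      have := congrArg (PlusOneSpherePair.projectiveMap A.symm) (congrArg Prod.fst h')
      simpa only [PlusOneSpherePair.projectiveMap_symm_apply] using this
    have h2 := congrArg Prod.snd h'
    exact Prod.ext h1 h2
  have hι'r : range ι' = UK := by
    rw [← hιr, hι']
    ext y
    constructor
    · rintro ⟨q, rfl⟩; exact ⟨_, rfl⟩
    · rintro ⟨q, rfl⟩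
      exact ⟨(PlusOneSpherePair.projectiveMap A.symm q.1, q.2), by simp only [PlusOneSpherePair.projectiveMap_apply_symm]⟩
  have hgι' : ∀ q, g (ι' q) = q.2 := fun q => by rw [hι']; exact hgι _
  have hGι' : ∀ θ, G θ = ι' (θ, s) := fun θ => by rw [hι']; exact hG θ
  -- the product chart `Φ`
  refine ⟨UK, g, prodChart 0 ι', s, ?_⟩
  have hΦU : ∀ q, prodChart 0 ι' q ∈ UK := fun q => by rw [← hι'r, prodChart_apply]; exact ⟨_, rfl⟩
  have hgΦ : ∀ q : ℂ × ℂ, g (prodChart 0 ι' q) = q.2 := fun q => by rw [prodChart_apply, hgι']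
  have hΦinj : Injective (prodChart 0 ι') := prodChart_injective 0 hι'inj
  -- the crossing parameters
  obtain ⟨zc, hzc⟩ : ∃ zc : ℂ → ℂ, ∀ ζ, prodChart 0 ι' (ζ, s) ∈ range u → u (zc ζ) = prodChart 0 ι' (ζ, s) := by
    refine ⟨fun ζ => if h : prodChart 0 ι' (ζ, s) ∈ range u then h.choose else 0, fun ζ h => ?_⟩
    simp only [dif_pos h]
    exact h.choose_spec
  have hmaps : ∀ ζ, prodChart 0 ι' (ζ, s) ∈ range u → u (zc ζ) ∈ UK ∧ g (u (zc ζ)) = s := fun ζ h => by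
    rw [hzc ζ h]; exact ⟨hΦU _, hgΦ _⟩
  have hinjOn : InjOn zc {ζ | prodChart 0 ι' (ζ, s) ∈ range u} := by
    intro ζ hζ ζ' hζ' h
    have : prodChart 0 ι' (ζ, s) = prodChart 0 ι' (ζ', s) := by rw [← hzc ζ hζ, ← hzc ζ' hζ', h]
    exact congrArg Prod.fst (hΦinj this)
  have hS₀ : {ζ | prodChart 0 ι' (ζ, s) ∈ range u}.Finite :=
    Set.Finite.of_finite_image (hfin.subset (by rintro _ ⟨ζ, hζ, rfl⟩; exact hmaps ζ hζ)) hinjOn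
  refine ⟨hS₀.toFinset, zc, G, hUK, hg, contMDiff_prodChart 0 hι's, injective_mfderiv_prodChart 0 hι's hι'd, hΦU, hgΦ,
    fun ζ hζ => (hzc ζ (hS₀.mem_toFinset.1 hζ)).symm,
    fun ζ hζ => hreg _ (hmaps ζ (hS₀.mem_toFinset.1 hζ)).1 (hmaps ζ (hS₀.mem_toFinset.1 hζ)).2, ?_, ?_, ?_, hGF⟩
  · -- the count, re-indexed over `ZK` through the bijection `zc : ZK → Z`
    refine ⟨r₀, hr₀, fun r hr hrle => ?_⟩
    have himage : hS₀.toFinset.image zc = hfin.toFinset := by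
      ext z
      simp only [Finset.mem_image, Set.Finite.mem_toFinset, mem_setOf_eq]
      constructor
      · rintro ⟨ζ, hζ, rfl⟩; exact hmaps ζ hζ
      · rintro ⟨hzU, hzs⟩
        have hzU' : u z ∈ range ι' := by rw [hι'r]; exact hzU
        obtain ⟨⟨θ, t⟩, hθ⟩ := hzU'
        have ht : t = s := by
          have := hgι' (θ, t)
          rw [hθ, hzs] at this
          exact this.symm
        subst ht
        rcases eq_linePt_zero_or_eq_linePt_one_zero θ with ⟨ζ, rfl⟩ | rfl
        · have hmem : prodChart 0 ι' (ζ, t) ∈ range u := by rw [prodChart_apply]; exact ⟨z, hθ.symm⟩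
          exact ⟨ζ, hmem, huinj ((hzc ζ hmem).trans (by rw [prodChart_apply, hθ]))⟩
        · exact absurd (Or.inl ⟨z, by rw [hGι']; exact hθ.symm⟩ : G (CodimTwoData.linePt 1 0) ∈ range u ∪ {v 0}) hGinf
    have hs := hsum r hr hrle
    rw [finsum_mem_eq_finite_toFinset_sum _ hfin, ← himage, Finset.sum_image fun ζ hζ ζ' hζ' h =>
      hinjOn ((hS₀.mem_toFinset).1 hζ) ((hS₀.mem_toFinset).1 hζ') h] at hs
    exact hs
  · intro z; rw [hGι', prodChart_apply]
  · intro θ hθ hmem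
    rcases eq_linePt_zero_or_eq_linePt_one_zero θ with ⟨ζ, rfl⟩ | rfl
    · have hζ : ζ ∉ hS₀.toFinset := fun h => hθ ⟨ζ, h, rfl⟩
      rw [Set.Finite.mem_toFinset, mem_setOf_eq] at hζ
      rcases hmem with h | h
      · exact hζ (by rw [prodChart_apply, ← hGι']; exact h)
      · have hv : v 0 = prodChart 0 ι' (ζ, s) := by rw [prodChart_apply, ← hGι']; exact (mem_singleton_iff.1 h).symm
        exact hv0K ⟨hv ▸ hΦU _, by rw [hv, hgΦ]⟩
    · exact hGinf hmem

end Summit.SmoothPoincare4.SmoothPoincare4.Theorems.GromovRecognitionRelEnd.CrossCapLaurent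

end
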